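import Literature.NumberTheory.EllipticCurves.HeegnerPointsKolyvaginPrimaryAnnihilatorLeavesProofs
import HarnessLib

/-!
# Kolyvagin's annihilation `p^m · Ш(E/K)[p^∞] = 0` at ONE odd prime `p` with `ρ̄_{E,p}` onto,
# `m` the `p`-divisibility exponent of `y_K` in `E(K)` — Kolyvagin's exponent (not `2m`)

Sibling proof file (theorems only: no definition, no named fact, no `sorry`) of
`HeegnerPointsKolyvaginPrimaryAnnihilatorProofs` / `…AnnihilatorLeavesProofs`, and the sharpening
of `HeegnerPointsKolyvaginPrimaryExponentProofs` (exponent `2m` there, from Gross's Claim 10.3) to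
Kolyvagin's exponent `m` (V. A. Kolyvagin, Proc. ICM Kyoto 1990, §2: `C' S'_M = 0`, `C = p^{M₀}`),
paid for by the reciprocity law at TWO Kolyvagin places (McCallum 1991, §2 Prop. 2.2 is a sum over
ALL places; leaf (B₂) below).  The ORDER form `ord_p #Ш(E/K) ≤ 2 ord_p [E(K) : ℤ y_K]` of
McCallum 1991, §1 Theorem (Kolyvagin) — the tree's named fact
`Kolyvagin1990_padicValNat_card_sha_le` — is NOT obtained here and is strictly stronger than both
exponent forms (it needs the Cassels–Tate pairing of Kolyvagin's classes, McCallum Prop. 4.7 and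
Thm. 5.4).

* `pow_smul_sha_primary_eq_zero_at_of_leavesM₂` — **`p^m · Ш(E/K)[p^∞] = 0`** for every `m` with
  `p^{m+1} ∤ y_K` in `E(K)`, from the `p`-slice of the leaves: (A) Kolyvagin's classes with McCallum
  (6), Lemma 4.3, Prop. 4.4, Gross Props. 5.3 / 5.4 (2); (B) one-place duality; (B₂) two-place
  duality — all in order form, all hypotheses;
* `pow_smul_sha_primary_eq_zero_at_of_pointsM_of_reciprocityFinset` — the same from Heegner-type
  points (binder `hpoints` of the tree's `…_at_of_pointsM_of_reciprocityM`, VERBATIM) and Kolyvagin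
  reciprocity in PAIRING form against Selmer classes vanishing on a finite set of places (`hRT`);
* the case `m = 0` (`p ∤ y_K ⟹ Ш(E/K)[p^∞] = 0`, Gross 1991, Prop. 2.1 (2)) is already the tree's
  `sha_primary_eq_zero_at_of_pointsM_of_reciprocityM_of_not_dvd` (sibling `…PrimaryExponentProofs`,
  under the one-place reciprocity hypothesis of that file) and is not restated here.

Proof: `E(K)[p] = 0` (`torsionBy_eq_bot_of_isImaginaryQuadratic`), McCallum's Lemma 5.1
(`exists_kummer_generator_pow`), the data with two-place duality at every level `p^j`, `j ≥ 1`
(`exists_hypothesesM₂_of_leavesM`), the passage to `Ш`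
(`pow_M₀_smul_sha_primary_eq_zero_of_hypothesesM_of_le`), and `M₀ ≤ m`.

## References

* [McCallumLMS1991] W. G. McCallum, *Kolyvagin's work on Shafarevich–Tate groups*, LMS LN 153
  (1991): §1 Theorem (Kolyvagin), Lemma 5.1, §2 Prop. 2.2, §§4–5 (held, PDF pp. 276–287).
* [GrossLMS1991] B. H. Gross, *Kolyvagin's work on modular elliptic curves*, same volume,
  Thm. 1.3 (2), Prop. 2.1 (2), §10 (held, PDF pp. 213–215, 229–231).
* [Kolyvagin1990] V. A. Kolyvagin, Proc. ICM Kyoto 1990, §2 (read: galaxy panama:376007206895683);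
  *Euler systems* (1990), Thm. A (cite only; acq-00132).
-/

noncomputable section

open scoped Classical
open WeierstrassCurve NumberField IsDedekindDomain
open Literature.NumberTheory.GaloisRepresentations

universe u

namespace Literature.NumberTheory.EllipticCurves

namespace KolyvaginDescent

variable {N : ℕ} [NeZero N] (W : WeierstrassCurve ℚ) {K : Type u} [Field K] [NumberField K]

/-! ## At one prime, from the mod-`p^M` leaves (A) + (B) + (B₂) -/

/-- **`p^m · Ш(E/K)[p^∞] = 0` at one odd prime `p` with `ρ̄_{E,p}` onto, for every `m` with
`p^{m+1} ∤ y_K` in `E(K)`, from the mod-`p^M` leaves (A) + (B) + (B₂) at that prime** (Kolyvagin's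
exponent; McCallum 1991, §1 Theorem in exponent form with `m`, Lemma 5.1).  Hypotheses: those of
the tree's `pow_smul_sha_primary_eq_zero_at_of_leavesM` with the leaf slice `hleaves` extended by the
two-place duality clause (B₂) (last conjunct). [cite: McCallumLMS1991, §1 Theorem (Kolyvagin),
Lemma 5.1, §2 Prop. 2.2, §§4–5] [cite: GrossLMS1991, §1 Thm. 1.3 (2), §10] -/
theorem pow_smul_sha_primary_eq_zero_at_of_leavesM₂ [W.IsElliptic] (hK : IsImaginaryQuadratic K)
    {P : (W.baseChange K).toAffine.Point} (hnt : ¬ IsOfFinAddOrder P) {p : ℕ} (hp : p.Prime)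
    (hp2 : p ≠ 2) (hρ : W.HasSurjectiveModNGaloisRep p) {m : ℕ}
    (hm : ∀ Q : (W.baseChange K).toAffine.Point, p ^ (m + 1) • Q ≠ P)
    (hC : Automorphic.chebotarev_artinRep) (hW : W.exists_weilPairing p)
    (hleaves : ∀ {M : ℕ} (_hM : 1 ≤ M)
      (hdiv : ∀ Q : geomPoints (W.baseChange K), ∃ R, ((p ^ M : ℕ) : ℤ) • R = Q)
      (c : K ≃ₐ[ℚ] K) (_hc : c ≠ 1),
      ∃ (ε : ℤ) (cl : ℕ → galH1Torsion (W.baseChange K) ((p ^ M : ℕ) : ℤ)),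
        (ε = 1 ∨ ε = -1) ∧
        IsOfFinAddOrder (Affine.Point.map (W' := W) (c : K →ₐ[ℚ] K) P - ε • P) ∧
        cl 1 = kummerMapTorsion (W.baseChange K) _ hdiv P ∧
        (∀ m : ℕ, Squarefree m →
          (∀ q ∈ m.primeFactors, IsKolyvaginPrime N W K p q ∧ FrobEqFrobInfty W K (p ^ M) q) →
          conjAct W c _ (cl m) = (ε * (-1) ^ m.primeFactors.card) • cl m ∧
          (∀ v : HeightOneSpectrum (𝓞 K), (m : 𝓞 K) ∉ v.asIdeal →
            cl m ∈ selmerLocalKer (W.baseChange K) (v.adicCompletion K) ((p ^ M : ℕ) : ℤ)) ∧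
          (∀ ℓ : ℕ, ℓ.Prime → ℓ ∣ m → ∀ v : HeightOneSpectrum (𝓞 K), (ℓ : 𝓞 K) ∈ v.asIdeal →
            ∀ a : ℕ, (((p : ℤ) ^ a) • cl m ∈
                selmerLocalKer (W.baseChange K) (v.adicCompletion K) ((p ^ M : ℕ) : ℤ) ↔
              ((p : ℤ) ^ a) • cl (m / ℓ) ∈
                (W.baseChange K).torsionLocalKer (v.adicCompletion K) ((p ^ M : ℕ) : ℤ)))) ∧
        (∀ ℓ : ℕ, IsKolyvaginPrime N W K p ℓ ∧ FrobEqFrobInfty W K (p ^ M) ℓ →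
          ∀ ν : ℤ, (ν = 1 ∨ ν = -1) → ∀ d : galH1Torsion (W.baseChange K) ((p ^ M : ℕ) : ℤ),
          conjAct W c _ d = ν • d →
          (∀ v : HeightOneSpectrum (𝓞 K), (ℓ : 𝓞 K) ∉ v.asIdeal →
            d ∈ selmerLocalKer (W.baseChange K) (v.adicCompletion K) ((p ^ M : ℕ) : ℤ)) →
          (∀ w : InfinitePlace K,
            d ∈ selmerLocalKer (W.baseChange K) w.Completion ((p ^ M : ℕ) : ℤ)) →
          ∀ s ∈ selmerGroup (W.baseChange K) ((p ^ M : ℕ) : ℤ), conjAct W c _ s = ν • s →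
          ∀ a : ℕ, a < M → ∀ v : HeightOneSpectrum (𝓞 K), (ℓ : 𝓞 K) ∈ v.asIdeal →
            ((p : ℤ) ^ a) • d ∉
              selmerLocalKer (W.baseChange K) (v.adicCompletion K) ((p ^ M : ℕ) : ℤ) →
            ((p : ℤ) ^ (M - 1 - a)) • s ∈
              (W.baseChange K).torsionLocalKer (v.adicCompletion K) ((p ^ M : ℕ) : ℤ)) ∧
        (∀ ℓ ℓ' : ℕ, IsKolyvaginPrime N W K p ℓ ∧ FrobEqFrobInfty W K (p ^ M) ℓ →
          IsKolyvaginPrime N W K p ℓ' ∧ FrobEqFrobInfty W K (p ^ M) ℓ' → ℓ ≠ ℓ' →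
          ∀ ν : ℤ, (ν = 1 ∨ ν = -1) → ∀ d : galH1Torsion (W.baseChange K) ((p ^ M : ℕ) : ℤ),
          conjAct W c _ d = ν • d →
          (∀ v : HeightOneSpectrum (𝓞 K), (ℓ : 𝓞 K) ∉ v.asIdeal → (ℓ' : 𝓞 K) ∉ v.asIdeal →
            d ∈ selmerLocalKer (W.baseChange K) (v.adicCompletion K) ((p ^ M : ℕ) : ℤ)) →
          (∀ w : InfinitePlace K,
            d ∈ selmerLocalKer (W.baseChange K) w.Completion ((p ^ M : ℕ) : ℤ)) →
          ∀ s ∈ selmerGroup (W.baseChange K) ((p ^ M : ℕ) : ℤ), conjAct W c _ s = ν • s →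
          (∀ v : HeightOneSpectrum (𝓞 K), (ℓ' : 𝓞 K) ∈ v.asIdeal →
            s ∈ (W.baseChange K).torsionLocalKer (v.adicCompletion K) ((p ^ M : ℕ) : ℤ)) →
          ∀ a : ℕ, a < M → ∀ v : HeightOneSpectrum (𝓞 K), (ℓ : 𝓞 K) ∈ v.asIdeal →
            ((p : ℤ) ^ a) • d ∉
              selmerLocalKer (W.baseChange K) (v.adicCompletion K) ((p ^ M : ℕ) : ℤ) →
            ((p : ℤ) ^ (M - 1 - a)) • s ∈
              (W.baseChange K).torsionLocalKer (v.adicCompletion K) ((p ^ M : ℕ) : ℤ))) :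
    ∀ d : (W.baseChange K).sha, (∃ j : ℕ, p ^ j • d = 0) → p ^ m • d = 0 := by
  haveI : (W.baseChange K).IsElliptic := inferInstanceAs (W.map (algebraMap ℚ K)).IsElliptic
  obtain ⟨c, hc, hcc⟩ := exists_conj_of_isImaginaryQuadratic K hK
  -- `E(K)[p] = 0`, `M₀`, `x₀` (McCallum Lemma 5.1)
  have hbot := torsionBy_eq_bot_of_isImaginaryQuadratic W K hK hp hp2 hρ
  have hA : ∀ a : (W.baseChange K).toAffine.Point, p • a = 0 → a = 0 := fun a ha ↦ by
    have : a ∈ AddSubgroup.torsionBy (W.baseChange K).toAffine.Point (p : ℤ) := by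
      rw [mem_torsionBy_iff, natCast_zsmul]; exact ha
    rw [hbot] at this
    exact this
  obtain ⟨M₀, x₀, hx₀, -, hgen⟩ := exists_kummer_generator_pow (W.baseChange K) hp hA hnt
  -- `M₀ ≤ m`: otherwise `p^{m+1} (p^{M₀-(m+1)} x₀) = P`
  have hM₀m : M₀ ≤ m := by
    by_contra h
    refine hm (p ^ (M₀ - (m + 1)) • x₀) ?_
    rw [smul_smul, ← pow_add, show m + 1 + (M₀ - (m + 1)) = M₀ by omega, hx₀]
  have hdivj : ∀ j : ℕ, ∀ Q : geomPoints (W.baseChange K), ∃ R, ((p ^ j : ℕ) : ℤ) • R = Q :=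
    fun j ↦ (W.baseChange K).zsmul_geomPoints_surjective_holds
      (by exact_mod_cast pow_ne_zero j hp.ne_zero)
  -- descent data with two-place duality at every level `p^j`, `j ≥ 1`, from the leaves at THIS `p`
  have key : ∀ j : ℕ, 1 ≤ j →
      ∃ S : HypothesesM (galH1Torsion (W.baseChange K) ((p ^ j : ℕ) : ℤ))
          (HeightOneSpectrum (𝓞 K) ⊕ InfinitePlace K),
        S.Sel = selmerGroup (W.baseChange K) ((p ^ j : ℕ) : ℤ) ∧
        S.x = kummerMapTorsion (W.baseChange K) _ (hdivj j) x₀ ∧ S.p = p ∧ S.M₀ = M₀ ∧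
        S.M = j ∧
        (∀ ℓ ℓ', S.Kol ℓ → S.Kol ℓ' → ℓ ≠ ℓ' → ∀ ν : ℤ, (ν = 1 ∨ ν = -1) → ∀ d, S.τ d = ν • d →
          (∀ v, v ≠ S.pl ℓ → v ≠ S.pl ℓ' → d ∈ S.Loc v) →
          ∀ s ∈ S.Sel, S.τ s = ν • s → s ∈ S.A ℓ' →
          ∀ a, a < S.M → ((S.p : ℤ) ^ a) • d ∉ S.Loc (S.pl ℓ) →
            ((S.p : ℤ) ^ (S.M - 1 - a)) • s ∈ S.A ℓ) := by
    intro j hj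
    obtain ⟨ε, cl, hε, h53, hc1, hcl, hdual, hdual₂⟩ := hleaves hj (hdivj j) c hc
    obtain ⟨hPx, hxord⟩ := hgen j (by omega) (hdivj j)
    exact exists_hypothesesM₂_of_leavesM (N := N) W hK hp hp2 hρ hC hW hj (hdivj j) hc hcc
      hx₀ hPx hxord ε hε h53 cl hc1 hcl hdual hdual₂
  choose S hS using key
  intro d hd
  have hM₀ : p ^ M₀ • d = 0 :=
    pow_M₀_smul_sha_primary_eq_zero_of_hypothesesM_of_le (W.baseChange K) hp M₀ 1 S
      (fun j hj ↦ (hS j hj).2.2.1) (fun j hj ↦ (hS j hj).2.2.2.1) (fun j hj ↦ (hS j hj).1)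
      (fun j hj ↦ by
        rw [(hS j hj).2.1, AddMonoidHom.mem_ker]
        exact torsionH1ToH1_kummerMapTorsion _ _ _ x₀)
      (fun j hj ↦ (hS j hj).2.2.2.2.2) d hd
  rw [show m = (m - M₀) + M₀ by omega, pow_add, mul_smul, hM₀, smul_zero]

/-! ## At one prime, from Heegner-type points and Kolyvagin reciprocity in pairing form -/

/-- **`p^m · Ш(E/K)[p^∞] = 0` at one odd prime `p` with `ρ̄_{E,p}` onto, for every `m` with
`p^{m+1} ∤ y_K` in `E(K)`, from Heegner-type points and Kolyvagin reciprocity (pairing form, against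
Selmer classes vanishing on finite sets of places) at that prime** — Kolyvagin's exponent.
Hypotheses: `hpoints` = the binder of the tree's
`pow_smul_sha_primary_eq_zero_at_of_pointsM_of_reciprocityM` VERBATIM (leaf (A′) at `p`); `hRT` =
Kolyvagin reciprocity at the Kolyvagin primes of `(p, M)`, for every finite set `T` of finite
places: `e([s, F], [c', σ]) = 0` for `s ∈ S_{p^M}(E/K)` vanishing on `T` and `c'` Selmer off
`T ∪ {λ}` and at infinity (McCallum Prop. 2.2 with Lemma 5.3 / Gross (7.6); at `T = ∅` the tree's
(R)_M).  Čebotarev and Weil from the tree, the classes and signs by `exists_leafA_of_points`, leaves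
(B) and (B₂) by `hdual_of_kolyvaginReciprocityFinset` / `hdual₂_of_kolyvaginReciprocityFinset`.
[cite: McCallumLMS1991, §1 Theorem (Kolyvagin), Lemma 5.1, §2 Prop. 2.2, §§4–5]
[cite: GrossLMS1991, §1 Thm. 1.3 (2), §§3–8, §10] -/
theorem pow_smul_sha_primary_eq_zero_at_of_pointsM_of_reciprocityFinset [W.IsElliptic]
    (hK : IsImaginaryQuadratic K) {P : (W.baseChange K).toAffine.Point}
    (hP : IsHeegnerPoint N W K P) (hnt : ¬ IsOfFinAddOrder P) {p : ℕ} (hp : p.Prime)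
    (hp2 : p ≠ 2) (hρ : W.HasSurjectiveModNGaloisRep p) {m : ℕ}
    (hm : ∀ Q : (W.baseChange K).toAffine.Point, p ^ (m + 1) • Q ≠ P)
    (hpoints : ∀ {M : ℕ} (_hM : 1 ≤ M)
      (hdiv : ∀ Q : geomPoints (W.baseChange K), ∃ R, ((p ^ M : ℕ) : ℤ) • R = Q)
      (c : K ≃ₐ[ℚ] K) (_hc : c ≠ 1),
      ∃ (ε : ℤ) (τ : AlgebraicClosure K ≃+* AlgebraicClosure K) (hτ : IsLiftOfAut c τ)
        (A : ℕ → AddSubgroup (geomPoints (W.baseChange K)))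
        (hA : ∀ m, KolyvaginCocycle.IsAdmissible (Field.absoluteGaloisGroup K) (A m)
          ((p ^ M : ℕ) : ℤ))
        (Pt : ℕ → geomPoints (W.baseChange K))
        (hPt : ∀ m, Pt m ∈
          KolyvaginCocycle.invPoints (Field.absoluteGaloisGroup K) (A m) ((p ^ M : ℕ) : ℤ)),
        (ε = 1 ∨ ε = -1) ∧
        IsOfFinAddOrder (Affine.Point.map (W' := W) (c : K →ₐ[ℚ] K) P - ε • P) ∧
        (∀ m, ∀ a ∈ A m, hτ.pointsMap W a ∈ A m) ∧
        Pt 1 = toGeomPoints (W.baseChange K) P ∧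
        (∀ m : ℕ, Squarefree m →
          (∀ q ∈ m.primeFactors, IsKolyvaginPrime N W K p q ∧ FrobEqFrobInfty W K (p ^ M) q) →
          (∃ B ∈ A m, hτ.pointsMap W (Pt m) =
            (ε * (-1) ^ m.primeFactors.card) • Pt m + ((p ^ M : ℕ) : ℤ) • B) ∧
          (∀ v : HeightOneSpectrum (𝓞 K), (m : 𝓞 K) ∉ v.asIdeal →
            kolyvaginClass (W.baseChange K) _ hdiv (hA m) (Pt m) (hPt m) ∈
              selmerLocalKer (W.baseChange K) (v.adicCompletion K) ((p ^ M : ℕ) : ℤ)) ∧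
          (∀ ℓ : ℕ, ℓ.Prime → ℓ ∣ m → ∀ v : HeightOneSpectrum (𝓞 K), (ℓ : 𝓞 K) ∈ v.asIdeal →
            ∀ a : ℕ, (((p : ℤ) ^ a) •
                kolyvaginClass (W.baseChange K) _ hdiv (hA m) (Pt m) (hPt m) ∈
                selmerLocalKer (W.baseChange K) (v.adicCompletion K) ((p ^ M : ℕ) : ℤ) ↔
              ((p : ℤ) ^ a) • kolyvaginClass (W.baseChange K) _ hdiv (hA (m / ℓ)) (Pt (m / ℓ))
                  (hPt (m / ℓ)) ∈
                (W.baseChange K).torsionLocalKer (v.adicCompletion K) ((p ^ M : ℕ) : ℤ)))))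
    (hRT : ∀ {M : ℕ} (_hM : 1 ≤ M) {ℓ : ℕ} (hℓ : IsKolyvaginPrime N W K p ℓ),
      FrobEqFrobInfty W K (p ^ M) ℓ →
      ∃ (A : Type u) (_ : AddCommGroup A)
        (e : geomTorsion (W.baseChange K) ((p ^ M : ℕ) : ℤ) →+
          geomTorsion (W.baseChange K) ((p ^ M : ℕ) : ℤ) →+ A),
        (∀ x, e x x = 0) ∧ (∀ x, (∀ y, e x y = 0) → x = 0) ∧
        ∀ (T : Finset (HeightOneSpectrum (𝓞 K))),
        ∀ s ∈ selmerGroup (W.baseChange K) ((p ^ M : ℕ) : ℤ),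
          (∀ v ∈ T, s ∈ (W.baseChange K).torsionLocalKer (v.adicCompletion K) ((p ^ M : ℕ) : ℤ)) →
          ∀ c' : galH1Torsion (W.baseChange K) ((p ^ M : ℕ) : ℤ),
          (∀ v : HeightOneSpectrum (𝓞 K), v ∉ T → (ℓ : 𝓞 K) ∉ v.asIdeal →
            c' ∈ selmerLocalKer (W.baseChange K) (v.adicCompletion K) ((p ^ M : ℕ) : ℤ)) →
          (∀ w : InfinitePlace K,
            c' ∈ selmerLocalKer (W.baseChange K) w.Completion ((p ^ M : ℕ) : ℤ)) →
          ∀ 𝔔 ∈ hℓ.place.primesAbove, ∀ F : Field.absoluteGaloisGroup K,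
            IsArithFrobAt (𝓞 K) F 𝔔 →
            F ∈ torsionFixing (W.baseChange K) ((p ^ M : ℕ) : ℤ) →
            ∀ σ ∈ 𝔔.inertia (Field.absoluteGaloisGroup K),
            e (h1Eval (W.baseChange K) ((p ^ M : ℕ) : ℤ) s F)
              (h1Eval (W.baseChange K) ((p ^ M : ℕ) : ℤ) c' σ) = 0) :
    ∀ d : (W.baseChange K).sha, (∃ j : ℕ, p ^ j • d = 0) → p ^ m • d = 0 := by
  refine pow_smul_sha_primary_eq_zero_at_of_leavesM₂ (N := N) W hK hnt hp hp2 hρ hm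
    Automorphic.chebotarev_artinRep_holds (W.exists_weilPairing_holds p) ?_
  intro M hM hdiv c hc
  obtain ⟨ε, τ, hτ, A, hA, Pt, hPt, hε, h53, hAτ, hPt1, hm'⟩ := hpoints hM hdiv c hc
  obtain ⟨cl, hc1, hcl⟩ := exists_leafA_of_points (N := N) hdiv c hτ ε A hA hAτ Pt hPt hPt1
    (fun m hm'' hk ↦ (hm' m hm'' hk).1) (fun m hm'' hk ↦ (hm' m hm'' hk).2.1)
    (fun m hm'' hk ↦ (hm' m hm'' hk).2.2)
  exact ⟨ε, cl, hε, h53, hc1, hcl,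
    hdual_of_kolyvaginReciprocityFinset W hK hP hp hp2 hM hc (fun hℓ hℓM ↦ hRT hM hℓ hℓM),
    hdual₂_of_kolyvaginReciprocityFinset W hK hP hp hp2 hM hc (fun hℓ hℓM ↦ hRT hM hℓ hℓM)⟩

end KolyvaginDescent

end Literature.NumberTheory.EllipticCurves

end
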